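import Summits.QuantumFields.YangMills.Theorems.ConvexGribovBodyBrascampLiebVacuumSCStubLieSimple
import Literature.MathematicalPhysics.QuantumFieldTheory.Balaban1983to89.B12Schur433
import Literature.Algebra.Lie.CompactKillingForm
import Summits.QuantumFields.YangMills.Theorems.BalabanLadderUVNonSUNRecDefs
import HarnessLib

/-!
# The one group datum of the non-`SU(N)` residual `UVNonSUNRec` (route `BalabanLadder`): the
# Killing∕trace ratio `λ(G, r) > 0` EXISTS for every compact simple `G` and every faithful unitary `r`

Helper for the residual leg `UVOtherGroups` (stmt-QuantumFields-19356) of route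
`route-QuantumFields-BalabanLadder`, more precisely for its non-`SU(N)` successor `UVNonSUNRec`
(owner ruling ym-beyond-p2 g20∕g21, R85 batch item 2) and the planner line
`Cruxes/UVNonSUNRec/Lines/birth.lean` (candidate `UVNonSUNRec-birth.lean` 420960d58324e780, cell
ym-beyond, seat ym-novel-YangMills-othergroups): this file DISCHARGES that line's first stub
`stub_lieRatio` with no hypotheses.

For a compact simple `G` (tree `IsCompactSimpleLieGroup`: connected, non-abelian, every closed
connected normal subgroup trivial or all, and linear) and ANY faithful continuous unitary
`r : LatticeRep G`, the concrete matrix Lie algebra `𝔨 = repLieSubalgebra r ⊂ 𝔲(r.N)` (closed-subgroup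
theorem, tree `RepLieAlgebra.lean`) has
* trivial centre (`center_repLieSubalgebra_eq_bot`, from the LANDED
  `LiePerfect.eq_zero_of_commute_lieAlg`: a central one-parameter generator of a compact simple group
  vanishes), hence NEGATIVE-DEFINITE Killing form and the Killing property (tree
  `CompactKillingForm.killingForm_apply_self_neg_of_le_unitaryLie`, `isKilling_of_le_unitaryLie`);
* no proper ideals and a non-zero bracket (`isSimple_repLieSubalgebra : LieAlgebra.IsSimple ℝ 𝔨`, from the
  LANDED classification-free `BrascampLiebVacuumSC.stub_lieSimple` and
  `LiePerfect.commute_rho_of_commute_lieAlg`);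
* hence, by Schur's lemma for the scalar centroid (tree
  `B12Schur433.exists_eq_mul_killingForm_of_killing_neg`), the `ad`-invariant Hilbert–Schmidt form
  `Re tr(XᴴY) = −Re tr(XY)` is a constant multiple of the Killing form: there is a unique `λ > 0` with
  **`κ(X, X) = λ · Re tr(X²)` on `𝔨`** (`exists_lieRatio`, `LieRatio.unique`); both sides are `< 0` for
  `X ≠ 0`.

`λ = C_A / T_r` is the ratio (adjoint Casimir)/(trace normalisation of `r`): `2N` for the fundamental
of `SU(N)`, `n − 2` for the vector of `SO(n)`, `1` for an adjoint representation.  It is the ONE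
group datum in the two-loop asymptotic-scaling unit `uRecOf λ β = (max β 1)^{51/121}·exp(−24π²β/(11λ))`
of the line (`1/g² = β·T_r` for the Wilson action `β Σ_p (N − Re tr r(U_p))`).

HONEST FRAMING: classical Lie theory (bookkeeping over landed theorems); nothing here is an estimate
or a claim about the Yang–Mills continuum limit or mass gap; the three XL stubs of the line
(Bałaban's programme per `(G, r)`, E0′, the non-triviality engine) are untouched.
No named facts are used; no `sorry`.  File authored by the planner seat ym-novel-YangMills-othergroups g4
(candidate 432c674c0de5048e, `LAND-REQUEST-LieRatio.md`); the definition `LieRatio` was split off into the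
D-0016 Defs companion and the module verified and landed by the prover seat ym-osasm-p2 g5.

References: B. C. Hall, GTM 222 (2015), Prop. 7.4, Thm. 3.20; M. Sepanski, *Compact Lie Groups*
(2007), Thm. 5.18; T. Bröcker–T. tom Dieck, GTM 98 (1985), V (5.13), (7.11)–(7.13); T. Bałaban,
Commun. Math. Phys. 109 (1987) 249, p. 251 («G semisimple, a Lie subgroup of U(N)») and p. 289.
-/

set_option autoImplicit false

noncomputable section

open scoped Matrix
open Literature.MathematicalPhysics.QuantumFieldTheory
open Literature.MathematicalPhysics.QuantumLattice
open Literature.Algebra.Lie.CompactKillingForm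
open Literature.MathematicalPhysics.QuantumFieldTheory.Balaban1983to89.B12Schur433
  (exists_eq_mul_killingForm_of_killing_neg nontrivial_of_isSimple)
open Summit.QuantumFields.YangMills.Cruxes.CovarianceBound.SupportWindow (LiePerfect.lieAlgCarrier_eq_coe
  LiePerfect.eq_zero_of_commute_lieAlg LiePerfect.commute_rho_of_commute_lieAlg)
open Summit.QuantumFields.YangMills.Theorems.BrascampLiebVacuumSC (stub_lieSimple)

namespace Summit.QuantumFields.YangMills.Theorems.UVNonSUNRec

/-! ## §1 The datum

`LieRatio r lam` (with `LieRatio.unique`, `LieRatio.pos`) is the route-posited definition of the companion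
D-0016 file `BalabanLadderUVNonSUNRecDefs.lean` (same namespace); this file proves it is INHABITED for every
compact simple `G` and faithful unitary `r` (`exists_lieRatio`, §4). -/

variable {G : Type} [Group G] [TopologicalSpace G]

/-! ## §2 `𝔨 ≤ 𝔲(N)`, the trace form versus the Hilbert–Schmidt form -/

section Compact

variable [CompactSpace G]

/-- `𝔨 = repLieSubalgebra r` consists of skew-Hermitian matrices: `𝔨 ≤ 𝔲(r.N)` (the tree's `unitaryLie`).
[cite: Hall2015, Proposition 3.24] -/
theorem repLieSubalgebra_le_unitaryLie (r : LatticeRep G) : repLieSubalgebra r ≤ unitaryLie (Fin r.N) := by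
  intro X hX
  rw [mem_unitaryLie_iff, ← Matrix.star_eq_conjTranspose]
  exact skewAdjoint.mem_iff.1 (repLieAlgebra_le_skewAdjoint r hX)

/-- `Xᴴ = −X` for `X ∈ 𝔨`. [cite: Hall2015, Proposition 3.24] -/
theorem conjTranspose_coe (r : LatticeRep G) (X : repLieSubalgebra r) :
    (X : Matrix (Fin r.N) (Fin r.N) ℂ)ᴴ = -(X : Matrix (Fin r.N) (Fin r.N) ℂ) :=
  mem_unitaryLie_iff.1 (repLieSubalgebra_le_unitaryLie r X.2)

/-- On `𝔨 ≤ 𝔲(N)` the trace form is MINUS the Hilbert–Schmidt form: `Re tr(X²) = −Re tr(XᴴX)`.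
[cite: Hall2015, Exercise 7.3] -/
theorem re_trace_mul_self_eq_neg_hsFormOn (r : LatticeRep G) (X : repLieSubalgebra r) :
    ((X : Matrix (Fin r.N) (Fin r.N) ℂ) * X).trace.re = -hsFormOn (Fin r.N) (repLieSubalgebra r) X X := by
  rw [hsFormOn_apply, conjTranspose_coe, Matrix.neg_mul, Matrix.trace_neg, Complex.neg_re, neg_neg]

/-- The trace form is NEGATIVE DEFINITE on `𝔨`: `Re tr(X²) < 0` for `X ≠ 0` (`= −‖X‖²_HS`). [cite: Hall2015, Exercise 7.3] -/
theorem re_trace_mul_self_neg (r : LatticeRep G) {X : repLieSubalgebra r} (hX : X ≠ 0) :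
    ((X : Matrix (Fin r.N) (Fin r.N) ℂ) * X).trace.re < 0 := by
  rw [re_trace_mul_self_eq_neg_hsFormOn, neg_lt_zero]
  exact lt_of_le_of_ne (hsFormOn_apply_self_nonneg _ X) fun h => hX (hsFormOn_definite _ X h.symm)

/-- The trace form is `≤ 0` on `𝔨`. [cite: Hall2015, Exercise 7.3] -/
theorem re_trace_mul_self_nonpos (r : LatticeRep G) (X : repLieSubalgebra r) :
    ((X : Matrix (Fin r.N) (Fin r.N) ℂ) * X).trace.re ≤ 0 := by
  rw [re_trace_mul_self_eq_neg_hsFormOn, neg_nonpos]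
  exact hsFormOn_apply_self_nonneg _ X

/-- Under `LieRatio r λ` BOTH forms are negative definite: `κ(X,X) = λ·Re tr(X²) < 0` for `X ≠ 0`. [folklore] -/
theorem LieRatio.killing_neg {r : LatticeRep G} {lam : ℝ} (h : LieRatio r lam) {X : repLieSubalgebra r}
    (hX : X ≠ 0) : killingForm ℝ (repLieSubalgebra r) X X < 0 := by
  rw [h.2.2 X]
  exact mul_neg_of_pos_of_neg h.1 (re_trace_mul_self_neg r hX)

/-! ## §3 Trivial centre, negative-definite Killing form, simplicity -/

variable [IsTopologicalGroup G]

/-- **The centre of `𝔨` is trivial** for a compact simple `G`: a central `X ∈ 𝔨` commutes with the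
defining set of `𝔨`, hence generates a central one-parameter subgroup of `G`, which simplicity forces to be
trivial (LANDED `LiePerfect.eq_zero_of_commute_lieAlg`). [cite: Sepanski2007, Theorem 5.18] -/
theorem center_repLieSubalgebra_eq_bot (hG : IsSimpleCompactGroup G) (r : LatticeRep G) :
    LieAlgebra.center ℝ (repLieSubalgebra r) = ⊥ := by
  rw [LieSubmodule.eq_bot_iff]
  intro X hX
  rw [LieAlgebra.center, LieModule.mem_maxTrivSubmodule] at hX
  have hXc : (X : Matrix (Fin r.N) (Fin r.N) ℂ) ∈ r.lieAlgCarrier := by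
    rw [LiePerfect.lieAlgCarrier_eq_coe]
    exact X.2
  have hcomm : ∀ Y ∈ r.lieAlgCarrier, Commute (X : Matrix (Fin r.N) (Fin r.N) ℂ) Y := by
    intro Y hY
    rw [LiePerfect.lieAlgCarrier_eq_coe] at hY
    have h := congrArg (fun Z : repLieSubalgebra r => (Z : Matrix (Fin r.N) (Fin r.N) ℂ)) (hX ⟨Y, hY⟩)
    simp only [LieSubalgebra.coe_bracket, LieRing.of_associative_ring_bracket, ZeroMemClass.coe_zero]
      at h
    -- `h : Y * X - X * Y = 0`
    exact (sub_eq_zero.1 h).symm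
  exact Subtype.ext (LiePerfect.eq_zero_of_commute_lieAlg hG r hXc hcomm)

/-- **Negative-definite Killing form on `𝔨`** for a compact simple `G`. [cite: BrockerTomDieck1985, V (5.13)] -/
theorem killingForm_apply_self_neg (hG : IsSimpleCompactGroup G) (r : LatticeRep G) {X : repLieSubalgebra r}
    (hX : X ≠ 0) : killingForm ℝ (repLieSubalgebra r) X X < 0 :=
  killingForm_apply_self_neg_of_le_unitaryLie (repLieSubalgebra_le_unitaryLie r)
    (center_repLieSubalgebra_eq_bot hG r) hX

/-- `𝔨` is a Killing Lie algebra (non-degenerate Killing form) for a compact simple `G`.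
[cite: BrockerTomDieck1985, V (5.13)] -/
theorem isKilling_repLieSubalgebra (hG : IsSimpleCompactGroup G) (r : LatticeRep G) :
    LieAlgebra.IsKilling ℝ (repLieSubalgebra r) :=
  isKilling_of_le_unitaryLie (repLieSubalgebra_le_unitaryLie r) (center_repLieSubalgebra_eq_bot hG r)

/-- **`G` non-abelian ⇒ `𝔨` non-abelian**: if all of `𝔨` commuted, every matrix commuting with the defining
set of `𝔨` — in particular every `r(a)`, since then each generator is central in `𝔨` and so vanishes —
would commute with `r(G)` (LANDED `LiePerfect.commute_rho_of_commute_lieAlg`: the commutant contains the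
exponential chart, an open subgroup of the connected `G`), making `r(G) ≅ G` abelian.
[cite: Sepanski2007, Theorem 5.18] -/
theorem not_isLieAbelian_repLieSubalgebra (hG : IsSimpleCompactGroup G) (r : LatticeRep G) :
    ¬IsLieAbelian (repLieSubalgebra r) := by
  intro hab
  haveI : ConnectedSpace G := hG.1
  -- every generator is central, hence zero
  have hzero : ∀ Y ∈ r.lieAlgCarrier, Y = 0 := by
    intro Y hY
    have hY' : Y ∈ repLieSubalgebra r := by
      rw [LiePerfect.lieAlgCarrier_eq_coe] at hY
      exact hY
    have hcen : (⟨Y, hY'⟩ : repLieSubalgebra r) ∈ LieAlgebra.center ℝ (repLieSubalgebra r) := by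
      rw [LieAlgebra.center, LieModule.mem_maxTrivSubmodule]
      intro Z
      exact hab.trivial Z _
    rw [center_repLieSubalgebra_eq_bot hG r, LieSubmodule.mem_bot] at hcen
    exact congrArg (fun Z : repLieSubalgebra r => (Z : Matrix (Fin r.N) (Fin r.N) ℂ)) hcen
  -- hence every matrix commutes with the defining set, hence with `r(G)`
  obtain ⟨a, b, hab'⟩ := hG.2.1
  have hcomm : Commute (r.ρ a) (r.ρ b) :=
    LiePerfect.commute_rho_of_commute_lieAlg r (fun Y hY => by rw [hzero Y hY]; exact Commute.zero_right _) b
  exact hab' (r.injective (by rw [map_mul, map_mul]; exact hcomm.eq))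

/-- **`𝔨 = repLieSubalgebra r` is a SIMPLE real Lie algebra** for a compact simple `G`: every Lie ideal is
`⊥` or `⊤` (LANDED classification-free `BrascampLiebVacuumSC.stub_lieSimple`, transported from `ad`-stable
real subspaces of `repLieAlgebra r` to `LieIdeal`s of the bundled subalgebra) and `𝔨` is not abelian.
[cite: Sepanski2007, Theorem 5.18] [cite: BrockerTomDieck1985, V (7.11)–(7.13)] -/
theorem isSimple_repLieSubalgebra (hG : IsCompactSimpleLieGroup G) (r : LatticeRep G) :
    LieAlgebra.IsSimple ℝ (repLieSubalgebra r) := by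
  refine { eq_bot_or_eq_top := fun I' => ?_, non_abelian := not_isLieAbelian_repLieSubalgebra hG.1 r }
  -- the commutator Lie ring structure on matrices (Mathlib's non-instance `LieRing.ofAssociativeRing`, the one carried by
  -- the type of `repLieSubalgebra r`), bound locally so that `LieSubalgebra.incl` elaborates
  letI : LieRing (Matrix (Fin r.N) (Fin r.N) ℂ) := LieRing.ofAssociativeRing
  -- push the ideal down to an `ad`-stable real subspace of `repLieAlgebra r`
  let ι : repLieSubalgebra r →ₗ[ℝ] Matrix (Fin r.N) (Fin r.N) ℂ := (repLieSubalgebra r).incl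
  have hι : ∀ X : repLieSubalgebra r, ι X = (X : Matrix (Fin r.N) (Fin r.N) ℂ) := fun X => rfl
  let I : Submodule ℝ (Matrix (Fin r.N) (Fin r.N) ℂ) := (I' : Submodule ℝ (repLieSubalgebra r)).map ι
  have hmemI : ∀ {Y : Matrix (Fin r.N) (Fin r.N) ℂ}, Y ∈ I ↔ ∃ y : repLieSubalgebra r, y ∈ I' ∧ (y : Matrix _ _ ℂ) = Y := by
    intro Y
    constructor
    · rintro ⟨y, hy, rfl⟩
      exact ⟨y, (LieSubmodule.mem_toSubmodule (N := I')).1 hy, rfl⟩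
    · rintro ⟨y, hy, rfl⟩
      exact ⟨y, (LieSubmodule.mem_toSubmodule (N := I')).2 hy, rfl⟩
  have hIL : I ≤ repLieAlgebra r := by
    intro Y hY
    obtain ⟨y, -, rfl⟩ := hmemI.1 hY
    exact y.2
  have hI : ∀ X ∈ repLieAlgebra r, ∀ Y ∈ I, X * Y - Y * X ∈ I := by
    intro X hX Y hY
    obtain ⟨y, hy, rfl⟩ := hmemI.1 hY
    refine hmemI.2 ⟨⁅(⟨X, hX⟩ : repLieSubalgebra r), y⁆, I'.lie_mem hy, ?_⟩
    rw [LieSubalgebra.coe_bracket, LieRing.of_associative_ring_bracket]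
  rcases stub_lieSimple G hG r I hIL hI with hbot | htop
  · left
    rw [LieSubmodule.eq_bot_iff]
    intro y hy
    have h0 : (y : Matrix (Fin r.N) (Fin r.N) ℂ) ∈ I := hmemI.2 ⟨y, hy, rfl⟩
    rw [hbot, Submodule.mem_bot] at h0
    exact Subtype.ext h0
  · right
    rw [eq_top_iff]
    intro z _
    have hz : (z : Matrix (Fin r.N) (Fin r.N) ℂ) ∈ I := by rw [htop]; exact z.2
    obtain ⟨y, hy, hyz⟩ := hmemI.1 hz
    rwa [← Subtype.ext hyz]

/-! ## §4 The ratio exists -/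

/-- **EXISTENCE OF THE KILLING∕TRACE RATIO** (discharges `stub_lieRatio` of the `UVNonSUNRec` birth line): for a
compact simple `G` and any faithful unitary `r`, there is `λ > 0` with `κ_𝔨(X, X) = λ · Re tr(X²)` on
`𝔨 = repLieSubalgebra r`.  Proof: Schur for the scalar centroid of the simple, Killing, negative-definite `𝔨`
(tree `B12Schur433.exists_eq_mul_killingForm_of_killing_neg`) applied to the `ad`-invariant Hilbert–Schmidt
form `Φ(X,Y) = Re tr(XᴴY)`: `Φ = c·κ`; at any `X₀ ≠ 0`, `Φ > 0 > κ` gives `c < 0`; `λ := (−c)⁻¹`.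
[cite: Hall2015, Proposition 7.4] [cite: Sepanski2007, Theorem 5.18] -/
theorem exists_lieRatio (hG : IsCompactSimpleLieGroup G) (r : LatticeRep G) : ∃ lam : ℝ, LieRatio r lam := by
  have h𝔲 := repLieSubalgebra_le_unitaryLie r
  haveI := isSimple_repLieSubalgebra hG r
  haveI := isKilling_repLieSubalgebra hG.1 r
  haveI : Nontrivial (repLieSubalgebra r) := nontrivial_of_isSimple ℝ (repLieSubalgebra r)
  have hneg : ∀ X : repLieSubalgebra r, X ≠ 0 → killingForm ℝ (repLieSubalgebra r) X X < 0 :=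
    fun X hX => killingForm_apply_self_neg hG.1 r hX
  obtain ⟨c, hc⟩ := exists_eq_mul_killingForm_of_killing_neg hneg
    (hsFormOn (Fin r.N) (repLieSubalgebra r)) (hsFormOn_lieInvariant h𝔲)
  obtain ⟨X₀, hX₀⟩ := exists_ne (0 : repLieSubalgebra r)
  have hΦpos : 0 < hsFormOn (Fin r.N) (repLieSubalgebra r) X₀ X₀ :=
    lt_of_le_of_ne (hsFormOn_apply_self_nonneg _ X₀) fun h => hX₀ (hsFormOn_definite _ X₀ h.symm)
  have hκ₀ := hneg X₀ hX₀
  have hc0 : c < 0 := by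
    by_contra h
    have h' : 0 ≤ c := not_lt.1 h
    have : hsFormOn (Fin r.N) (repLieSubalgebra r) X₀ X₀ ≤ 0 := by
      rw [hc X₀ X₀]
      exact mul_nonpos_of_nonneg_of_nonpos h' hκ₀.le
    exact absurd hΦpos (not_lt.2 this)
  refine ⟨(-c)⁻¹, inv_pos.2 (neg_pos.2 hc0), ⟨X₀, ?_⟩, fun X => ?_⟩
  · rw [re_trace_mul_self_eq_neg_hsFormOn]
    exact neg_ne_zero.2 hΦpos.ne'
  · have hc' : -c ≠ 0 := (neg_pos.2 hc0).ne'
    rw [re_trace_mul_self_eq_neg_hsFormOn, hc X X, ← neg_mul, ← mul_assoc, inv_mul_cancel₀ hc', one_mul]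

/-- The stub of the birth line, VERBATIM its signature (`∀`-packaged `exists_lieRatio`). [folklore] -/
theorem stub_lieRatio_holds :
    ∀ (G : Type) [Group G] [TopologicalSpace G] [IsTopologicalGroup G] [CompactSpace G],
      IsCompactSimpleLieGroup G → ∀ r : LatticeRep G, ∃ lam : ℝ, LieRatio r lam :=
  fun _ _ _ _ _ hG r => exists_lieRatio hG r

end Compact

end Summit.QuantumFields.YangMills.Theorems.UVNonSUNRec

end
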